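import Summits.HodgeConjecture.HodgeConjecture.Theorems.Ring2HypothesesDescentStandardBStrictAbelian
import HarnessLib

/-!
# Ring 2 hypotheses, descent face — ARAPURA 2006 COR. 7.5 ON THE REAL CARRIERS: `B`, hom ≡ num and semisimplicity for the
# Hilbert schemes of points of EVERY smooth projective complex surface, modulo the de Cataldo–Migliorini domination record

research route conditional on HC_CM; not a corollary; Q11.4-sentence-2 already refuted in dim ≥ 3.
Cell `pub-hodge-ring2` (Hodge ladder STAGE 3), seat `ring2-b05` (binder row b05
`Ring2.Hypotheses.MotivatedImpliesAlgebraicAV`), gen 41, fifth file (a corollary sheet of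
`Ring2HypothesesDescentStandardBStrictAbelian` §2 — Arapura's Cor. 4.3 «any variety motivated by a curve or surface»).
`HC_CM` (`Theses.RankFourFaces.CMAbelianHodge`) does not occur in this file; nothing here proves a case of the Hodge
conjecture; no binder of `BINDER-OWNERS.md` is discharged; row b05 stays OPEN and is not asserted. The ONE displayed
hypothesis is the tree's named fact `DecataldoMigliorini2002_hilbertScheme_isDominatedByPowers` (de Cataldo–Migliorini
2002 Thm. 6.2.1 / Arapura Thm. 7.4: `S^{[n]}` is dominated by the powers of `S`; a THEOREM in print, record of the stage-4
files `CorCM/Stage4StrictAbelianType`, NOT asserted here).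

D. Arapura, *Motivation for Hodge cycles*, Adv. Math. 207 (2006), §7: Thm. 7.4 «`M` is motivated by `X`» (`M = X^{[n]}`
the Hilbert scheme of `n` points of a smooth projective surface `X`) and Cor. 7.5 «The Lefschetz standard conjecture holds
for `M`» (from Cor. 4.3). On the carriers: `IsDominatedByPowers (2n) H 2 S` (the record) and the companion's
`standardConjectureBStar_of_isDominatedByPowers_of_dim_le_two` (`B⋆` on curves and surfaces is Lefschetz `(1,1)`, Kleiman's
product theorem, Arapura's clause `B`).

* `standardConjectureBStar_hilbertScheme_of_decataldoMigliorini` — **`B⋆(S^{[n]}, θ)` for every smooth projective complex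
  SURFACE `S`, every `n`, every `θ`**, modulo the record (for K3 surfaces the tree also holds Charles–Markman's `B` for the
  whole `K3^[n]` deformation TYPE as the named fact `CharlesMarkman2013_lefschetzStandard_K3HilbertType`; the present
  statement covers abelian, Enriques, elliptic, general-type … surfaces, but only the Hilbert schemes themselves);
* `nondegenerate_algebraicClasses_hilbertScheme_of_decataldoMigliorini` — hom ≡ num on `S^{[n]}` (with `ℂ`-coefficients);
* `standardConjectureBStar_hilbertScheme_pow_of_decataldoMigliorini` — the same for all cartesian powers `(S^{[n]})ʲ`.

HONEST COLUMN. No definition, no NEW named fact, no sorry; the record is displayed, never asserted. Not claimed: `B` for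
the deformation types (needs deformation invariance, Charles–Markman), generalized Kummer varieties (Xu's record in the tree
is stated for Hodge classes, not as a domination), OG6 / OG10.

PRESEARCH: [corpus: `paper:arxiv-math_0501348` Arapura 2006 §7 Thm. 7.4, Cor. 7.5 («The Lefschetz standard conjecture holds
for `M`»), p. 12 of the held text] — certification on the carriers modulo the domination record, no novelty in print claimed.

References (bib keys): Arapura2006 (§4 Cor. 4.3, §7 Thm. 7.4, Cor. 7.5), DecataldoMigliorini2002 (Thm. 6.2.1, Rem. 6.2.3),
Kleiman1968AlgebraicCycles (Cor. 2.5, 2A10), CharlesMarkman2013 (Thm. 1.1).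
-/

noncomputable section

-- every declaration of this problem lives in `Summit.HodgeConjecture.HodgeConjecture.…` (summit = sub-problem)
set_option linter.dupNamespace false

open CategoryTheory AlgebraicGeometry MonoidalCategory CartesianMonoidalCategory
open Literature.AlgebraicGeometry Literature.AlgebraicGeometry.Motives Literature.AlgebraicGeometry.HodgeTheory
open Literature.AlgebraicGeometry.HilbertScheme (IsHilbertSchemeOfPoints)
open Literature.AlgebraicTopology.SingularHomology

namespace Summit.HodgeConjecture.HodgeConjecture.Theorems

variable {S H : SchemeOver ℂ} {n : ℕ} {Ξ : (S ⊗ H).left.IdealSheafData}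

/-- **ARAPURA 2006 COR. 7.5 on the real carriers — `B⋆(S^{[n]}, θ)` for the Hilbert scheme of `n` points of EVERY smooth
projective complex surface `S` and every `θ`**, modulo the de Cataldo–Migliorini domination record (displayed hypothesis
`h74`, NOT asserted): `S^{[n]}` is dominated by the powers of the surface `S`, and varieties dominated by the powers of a
surface satisfy `B⋆` unconditionally (companion's `standardConjectureBStar_of_isDominatedByPowers_of_dim_le_two`).
[cite: Arapura2006, §7 Thm. 7.4 and Cor. 7.5] [cite: DecataldoMigliorini2002, Thm. 6.2.1 and Rem. 6.2.3] -/
theorem standardConjectureBStar_hilbertScheme_of_decataldoMigliorini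
    (h74 : DecataldoMigliorini2002_hilbertScheme_isDominatedByPowers) (hS : IsSmoothProjective 2 S)
    (hH : IsHilbertSchemeOfPoints n S H Ξ) (hHs : IsSmoothProjective (2 * n) H) (θ : complexBetti H 2) :
    StandardConjectureBStar (2 * n) H θ :=
  standardConjectureBStar_of_isDominatedByPowers_of_dim_le_two hHs hS le_rfl (h74 n Ξ hS hH hHs) θ

/-- **Hom ≡ num (with `ℂ`-coefficients) on `S^{[n]}`** for every smooth projective complex surface `S`, modulo the same
record: the cup pairing `Nᵖ H²ᵖ(S^{[n]}(ℂ)) × N^q H^{2q}(S^{[n]}(ℂ)) → H^{4n}`, `p + q = 2n`, is non-degenerate on both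
sides. [cite: Arapura2006, §4 Lemma 4.2 (clause D) and §7 Thm. 7.4] [cite: DecataldoMigliorini2002, Thm. 6.2.1] -/
theorem nondegenerate_algebraicClasses_hilbertScheme_of_decataldoMigliorini
    (h74 : DecataldoMigliorini2002_hilbertScheme_isDominatedByPowers) (hS : IsSmoothProjective 2 S)
    (hH : IsHilbertSchemeOfPoints n S H Ξ) (hHs : IsSmoothProjective (2 * n) H) {p q : ℕ} (hpq : p + q = 2 * n) :
    (∀ ξ ∈ algebraicClasses H p,
        (∀ b ∈ algebraicClasses H q, cupProduct (show 2 * p + 2 * q = 2 * (2 * n) by omega) ξ b = 0) → ξ = 0) ∧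
      (∀ b ∈ algebraicClasses H q,
        (∀ ξ ∈ algebraicClasses H p, cupProduct (show 2 * p + 2 * q = 2 * (2 * n) by omega) ξ b = 0) → b = 0) :=
  nondegenerate_algebraicClasses_of_isDominatedByPowers_of_dim_le_two hHs hS le_rfl (h74 n Ξ hS hH hHs) hpq

/-- **`B⋆` for all cartesian powers `(S^{[n]})ʲ`** (dimension `j · 2n`), every `θ`, modulo the same record.
[cite: Arapura2006, §4 Lemma 4.2 and §7 Cor. 7.5] [cite: DecataldoMigliorini2002, Thm. 6.2.1] -/
theorem standardConjectureBStar_hilbertScheme_pow_of_decataldoMigliorini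
    (h74 : DecataldoMigliorini2002_hilbertScheme_isDominatedByPowers) (hS : IsSmoothProjective 2 S)
    (hH : IsHilbertSchemeOfPoints n S H Ξ) (hHs : IsSmoothProjective (2 * n) H) (j : ℕ)
    (θ : complexBetti (H.pow j) 2) : StandardConjectureBStar (j * (2 * n)) (H.pow j) θ :=
  standardConjectureBStar_pow_of_isDominatedByPowers_of_dim_le_two hHs hS le_rfl (h74 n Ξ hS hH hHs) j θ

/-- **Semisimplicity of the algebra of algebraic correspondence operators on each `Hᵃ(S^{[n]}(ℂ); ℂ)`**, modulo the same
record (Jannsen's theorem on the carriers fed by `D(S^{[n]} × S^{[n]})`, the product being dominated by the powers of `S`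
as well). [cite: Jannsen1992, Thm. 1] [cite: Arapura2006, §4 Thm. 4.1 and §7 Thm. 7.4] -/
theorem isSemisimpleRing_adjoin_algebraicOperators_hilbertScheme_of_decataldoMigliorini
    (h74 : DecataldoMigliorini2002_hilbertScheme_isDominatedByPowers) (hS : IsSmoothProjective 2 S)
    (hH : IsHilbertSchemeOfPoints n S H Ξ) (hHs : IsSmoothProjective (2 * n) H) (a : ℕ) :
    IsSemisimpleRing (Algebra.adjoin ℂ ((algebraicClasses (H ⊗ H) (2 * n)).map
      (corrAction complexOrientationFamily hHs hHs (rfl : a + 2 * (2 * n) = a + 2 * (2 * n))) :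
        Set (Module.End ℂ (complexBetti H a)))) := by
  obtain ⟨η, hη⟩ := Ring2.Hypotheses.exists_isPolarizationClass_of_isSmoothProjective hS
  exact isSemisimpleRing_adjoin_algebraicOperators_of_isDominatedByPowers hHs hS (h74 n Ξ hS hH hHs)
    (fun k θ' ↦ forall_standardConjectureBStar_pow_of_standardConjectureBStar hS hη
      (forall_standardConjectureBStar_of_dim_le_two le_rfl hS η) (k + 1) θ') a

end Summit.HodgeConjecture.HodgeConjecture.Theorems

end
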